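import Literature.Analysis.FluidPDE.BiotSavartCurlPair
import Literature.Analysis.FluidPDE.MollifiedField
import HarnessLib

/-!
# Mollification commutes with `curl` and `∇` for `C¹` fields

Analysis/FluidPDE support file (all results proved, no definitions) on the decomposition path of
`Literature.Analysis.FluidPDE.MajdaBertozzi2002_holderEulerUniqueness` (`ElgindiAprioriBlowupProofs.lean`),
brick B1′ (finite speed of propagation of the vorticity support of a `C¹` Euler solution, by
mollifying the momentum equation in space). For a test kernel `ρ` and the mollification
`ρ ⋆ v = ∫ ρ(t) v(· − t) dt` (Mathlib's convolution with `lsmul`):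

* `integral_fderiv_comp_sub_smul_eq`: integration by parts moving the derivative from the kernel
  to a `C¹` field, `∫ ∂ₐρ(x − y) • v(y) dy = ∫ ρ(x − y) • ∂ₐv(y) dy`;
* `fderiv_convolution_lsmul_eq_integral` — **`D(ρ ⋆ v)(x) = ∫ ρ(x − y) • Dv(y) dy`** for `v ∈ C¹`
  (the tree's `fderiv_convolution_apply_eq`, derivative on the kernel, plus the integration by
  parts);
* `curl_convolution_lsmul` — **`curl (ρ ⋆ v) = ρ ⋆ curl v`** on `ℝ³` for `v ∈ C¹`;
* `convolution_lsmul_gradient` — **`ρ ⋆ ∇q = ∇(ρ ⋆ q)`** for `q ∈ C¹`, and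
  `curl_convolution_lsmul_gradient` — `curl (ρ ⋆ ∇q) = 0` (`ρ ⋆ q` is smooth).

[folklore] (Evans, *PDE*, App. C.4, Thm. 7: derivatives commute with mollification).
-/

noncomputable section

open MeasureTheory Set Filter Topology Function Metric InnerProductSpace ContinuousLinearMap
open scoped RealInnerProductSpace Convolution

namespace Literature.Analysis.FluidPDE

-- nested operator types
set_option maxSynthPendingDepth 3

section General

variable {E : Type*} [NormedAddCommGroup E] [InnerProductSpace ℝ E] [FiniteDimensional ℝ E]
  [MeasurableSpace E] [BorelSpace E]
variable {F : Type*} [NormedAddCommGroup F] [NormedSpace ℝ F]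
variable {ρ : E → ℝ} {v : E → F}

/-- **Integration by parts between a kernel and a `C¹` field**:
`∫ ∂ₐρ(x − y) • v(y) dy = ∫ ρ(x − y) • ∂ₐv(y) dy` for `ρ ∈ C¹_c`, `v ∈ C¹` (no boundary terms; the
sign of `∂_y ρ(x − y) = −∂ρ(x − y)` cancels the sign of the integration by parts). [folklore] -/
theorem integral_fderiv_comp_sub_smul_eq (hρ : ContDiff ℝ 1 ρ) (hρc : HasCompactSupport ρ)
    (hv : ContDiff ℝ 1 v) (x a : E) :
    ∫ y, (fderiv ℝ ρ (x - y) a) • v y = ∫ y, ρ (x - y) • fderiv ℝ v y a := by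
  have hρx : ContDiff ℝ 1 fun y => ρ (x - y) := hρ.comp (contDiff_const.sub contDiff_id)
  have hρxc : HasCompactSupport fun y => ρ (x - y) := hρc.comp_homeomorph (Homeomorph.subLeft x)
  have hP : ContDiff ℝ 1 fun y => ρ (x - y) • v y := hρx.smul hv
  have hPc : HasCompactSupport fun y => ρ (x - y) • v y := hρxc.smul_right
  have h0 := FluidPDE.integral_fderiv_apply_eq_zero hP hPc a
  have hpt : ∀ y, fderiv ℝ (fun y => ρ (x - y) • v y) y a =
      ρ (x - y) • fderiv ℝ v y a - (fderiv ℝ ρ (x - y) a) • v y := fun y => by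
    rw [fderiv_fun_smul (hρx.differentiable one_ne_zero y) (hv.differentiable one_ne_zero y),
      fderiv_comp_const_sub]
    simp only [_root_.add_apply, _root_.FunLike.coe_smul, Pi.smul_apply,
      ContinuousLinearMap.smulRight_apply, _root_.neg_apply, neg_smul]
    abel
  simp_rw [hpt] at h0
  have i1 : Integrable fun y => ρ (x - y) • fderiv ℝ v y a :=
    (hρx.continuous.smul ((hv.continuous_fderiv one_ne_zero).clm_apply continuous_const))
      |>.integrable_of_hasCompactSupport hρxc.smul_right
  have i2 : Integrable fun y => (fderiv ℝ ρ (x - y) a) • v y :=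
    ((((hρ.continuous_fderiv one_ne_zero).clm_apply continuous_const).comp
      (continuous_const.sub continuous_id)).smul hv.continuous).integrable_of_hasCompactSupport
      ((hρc.fderiv_apply (𝕜 := ℝ) a).comp_homeomorph (Homeomorph.subLeft x)).smul_right
  rw [integral_sub i1 i2, sub_eq_zero] at h0
  exact h0.symm

/-- **`D(ρ ⋆ v)(x) a = ∫ ρ(x − y) • ∂ₐv(y) dy`** for a `C¹_c` kernel and a `C¹` field. [folklore] -/
theorem fderiv_convolution_lsmul_apply_eq_integral (hρ : ContDiff ℝ 1 ρ) (hρc : HasCompactSupport ρ)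
    (hv : ContDiff ℝ 1 v) (x a : E) :
    fderiv ℝ (ρ ⋆[lsmul ℝ ℝ, volume] v) x a = ∫ y, ρ (x - y) • fderiv ℝ v y a := by
  rw [fderiv_convolution_apply_eq hρ hρc hv.continuous.locallyIntegrable x a,
    integral_fderiv_comp_sub_smul_eq hρ hρc hv x a]

/-- Integrability of `y ↦ ρ(x − y) • Dv(y)` (operator-valued). [folklore] -/
theorem integrable_comp_sub_smul_fderiv (hρ : ContDiff ℝ 1 ρ) (hρc : HasCompactSupport ρ)
    (hv : ContDiff ℝ 1 v) (x : E) : Integrable fun y => ρ (x - y) • fderiv ℝ v y :=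
  ((hρ.continuous.comp (continuous_const.sub continuous_id)).smul (hv.continuous_fderiv one_ne_zero))
    |>.integrable_of_hasCompactSupport (hρc.comp_homeomorph (Homeomorph.subLeft x)).smul_right

/-- **`D(ρ ⋆ v)(x) = ∫ ρ(x − y) • Dv(y) dy`** as operators. [folklore] -/
theorem fderiv_convolution_lsmul_eq_integral (hρ : ContDiff ℝ 1 ρ) (hρc : HasCompactSupport ρ)
    (hv : ContDiff ℝ 1 v) (x : E) :
    fderiv ℝ (ρ ⋆[lsmul ℝ ℝ, volume] v) x = ∫ y, ρ (x - y) • fderiv ℝ v y := by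
  refine ContinuousLinearMap.ext fun a => ?_
  rw [fderiv_convolution_lsmul_apply_eq_integral hρ hρc hv x a,
    ContinuousLinearMap.integral_apply (integrable_comp_sub_smul_fderiv hρ hρc hv x) a]
  rfl

/-- **`ρ ⋆ ∇q = ∇(ρ ⋆ q)`** for a `C¹_c` kernel and `q ∈ C¹`. [folklore] -/
theorem convolution_lsmul_gradient {q : E → ℝ} (hρ : ContDiff ℝ 1 ρ) (hρc : HasCompactSupport ρ)
    (hq : ContDiff ℝ 1 q) (x : E) :
    (ρ ⋆[lsmul ℝ ℝ, volume] gradient q) x = gradient (ρ ⋆[lsmul ℝ ℝ, volume] q) x := by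
  rw [gradient, fderiv_convolution_lsmul_eq_integral hρ hρc hq x, convolution_eq_swap]
  simp only [lsmul_apply]
  have hint := integrable_comp_sub_smul_fderiv hρ hρc hq x
  have hint2 : Integrable fun t => ρ (x - t) • gradient q t :=
    ((hρ.continuous.comp (continuous_const.sub continuous_id)).smul
      (FluidPDE.continuous_gradient_of_contDiff hq)).integrable_of_hasCompactSupport
      (hρc.comp_homeomorph (Homeomorph.subLeft x)).smul_right
  refine ext_inner_left ℝ fun a => ?_
  rw [← integral_inner hint2 a, real_inner_comm, InnerProductSpace.toDual_symm_apply,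
    ContinuousLinearMap.integral_apply hint a]
  refine integral_congr_ae (Eventually.of_forall fun t => ?_)
  simp only [_root_.FunLike.coe_smul, Pi.smul_apply, real_inner_smul_right, smul_eq_mul]
  rw [real_inner_comm, gradient, InnerProductSpace.toDual_symm_apply]

end General

/-! ### `curl` commutes with mollification on `ℝ³` -/

section Curl

variable {ρ : EuclideanSpace ℝ (Fin 3) → ℝ} {v : EuclideanSpace ℝ (Fin 3) → EuclideanSpace ℝ (Fin 3)}

/-- **`curl (ρ ⋆ v) = ρ ⋆ curl v`** for a `C¹_c` kernel and a `C¹` field on `ℝ³`. [folklore] -/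
theorem curl_convolution_lsmul (hρ : ContDiff ℝ 1 ρ) (hρc : HasCompactSupport ρ)
    (hv : ContDiff ℝ 1 v) (x : EuclideanSpace ℝ (Fin 3)) :
    curl (ρ ⋆[lsmul ℝ ℝ, volume] v) x = (ρ ⋆[lsmul ℝ ℝ, volume] curl v) x := by
  rw [curl_eq_curlCLM, fderiv_convolution_lsmul_eq_integral hρ hρc hv x,
    ← curlCLM.integral_comp_comm (integrable_comp_sub_smul_fderiv hρ hρc hv x),
    convolution_eq_swap]
  refine integral_congr_ae (Eventually.of_forall fun y => ?_)
  simp only [map_smul, lsmul_apply, curl_eq_curlCLM]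

/-- **`curl (ρ ⋆ ∇q) = 0`** for a smooth compactly supported kernel and `q ∈ C¹`: `ρ ⋆ ∇q = ∇(ρ ⋆ q)`
with `ρ ⋆ q` smooth, and `curl ∇ = 0`. [folklore] -/
theorem curl_convolution_lsmul_gradient {q : EuclideanSpace ℝ (Fin 3) → ℝ} (hρ : ContDiff ℝ (⊤ : ℕ∞) ρ)
    (hρc : HasCompactSupport ρ) (hq : ContDiff ℝ 1 q) (x : EuclideanSpace ℝ (Fin 3)) :
    curl (ρ ⋆[lsmul ℝ ℝ, volume] gradient q) x = 0 := by
  have hρ1 : ContDiff ℝ 1 ρ := contDiff_infty.1 hρ 1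
  have e : (ρ ⋆[lsmul ℝ ℝ, volume] gradient q) = gradient (ρ ⋆[lsmul ℝ ℝ, volume] q) :=
    funext fun y => convolution_lsmul_gradient hρ1 hρc hq y
  rw [e]
  have h2 : ContDiff ℝ 2 (ρ ⋆[lsmul ℝ ℝ, volume] q) :=
    hρc.contDiff_convolution_left _ (contDiff_infty.1 hρ 2) hq.continuous.locallyIntegrable
  exact curl_gradient_eq_zero_holds _ h2 x

end Curl

end Literature.Analysis.FluidPDE
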